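import Summits.HubbardSuperconductivity.HubbardSuperconductivity.Theorems.AnisotropyChordTransferFibre3KT2bTargets
import Summits.HubbardSuperconductivity.HubbardSuperconductivity.Theorems.AnisotropyChordTransferFibre3GroundState

/-!
# Route `AnisotropyChord` / H0 rotor rung: two supports of PartN32 — `NTermBound` and `DenMinRestClosed` from the lattice lemma

PartN32 = `…Fibre3KT2bTargets` (theory seat `hubbard-h0-rotor-theory-1`, memo 21 §304–§306):
* **`nTermBound_holds : NTermBound L Δ`** — `‖v·C0′‖² ≤ 9‖C0′‖²` since `|v| = |1 + e^{iK₁a} + e^{iK₁b}| ≤ 3`;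
* **`denMinRestClosed_of_lattice : DenMinRestClosed_of_lattice_stmt L`** — the lattice lemma `Σε ≥ (5+2cos θ)ε₁` off the
  poles and the low shell gives `den(T⁺) ≥ (4+2cos θ)ε₁ − T⁺ ≥ (2+cos θ)(2ε₁ − T⁺)` for `T⁺ ≥ 0` (pure arithmetic);
* **`denMinRest_of_lattice`**: `DenMinRestLattice L → 8 ≤ L → Δ ≤ 1 → DenMinRest L Δ (2 + cos(2π/L))` (the PartN31 currency
  consumed by `ktAssemblyAbs_holds` / `gm3_of_cruxes_coercive`; `T⁺ ≥ 0` by `Tplus_nonneg`).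
Prover seat `hubbard-h0-rotor-p1` g22; helper for stmt-HubbardSuperconductivity-19089 (`--supports`).
-/

set_option linter.dupNamespace false
set_option autoImplicit false

noncomputable section

open scoped BigOperators
open Complex

namespace Summit.HubbardSuperconductivity.HubbardSuperconductivity.Theorems.AnisotropyChord.Transfer.Fibre3

variable (L : ℕ) [NeZero L]

/-- `|v(c)|² ≤ 9`. [folklore] -/
theorem normSq_vfun_le (c : Cfg L) : Complex.normSq (vfun L c) ≤ 9 := by
  have h : ‖vfun L c‖ ≤ 3 := by
    unfold vfun
    calc ‖(1 : ℂ) + phase L (K1 L) c.1 + phase L (K1 L) c.2‖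
        ≤ ‖(1 : ℂ) + phase L (K1 L) c.1‖ + ‖phase L (K1 L) c.2‖ := norm_add_le _ _
      _ ≤ ‖(1 : ℂ)‖ + ‖phase L (K1 L) c.1‖ + ‖phase L (K1 L) c.2‖ := by
          have := norm_add_le (1 : ℂ) (phase L (K1 L) c.1); linarith
      _ = 3 := by rw [norm_one, norm_phase, norm_phase]; norm_num
  rw [Complex.normSq_eq_norm_sq]
  nlinarith [norm_nonneg (vfun L c)]

/-- **`NTermBound` holds:** `‖v·C0′‖² ≤ 9 ‖C0′‖²`. [folklore] -/
theorem nTermBound_holds (Δ : ℝ) : NTermBound L Δ := by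
  intro f
  unfold nNterm nC0p
  rw [Finset.mul_sum]
  apply Finset.sum_le_sum
  intro c _
  rw [Complex.normSq_mul]
  have h9 := normSq_vfun_le L c
  have h0 := Complex.normSq_nonneg (C0p L Δ f c)
  nlinarith

/-- **`DenMinRestClosed` from `DenMinRestLattice`** (pure arithmetic: `(2+c)(2ε₁ − T) ≤ (4+2c)ε₁ − T` for `T ≥ 0`, `c ≥ −1`). [folklore] -/
theorem denMinRestClosed_of_lattice : DenMinRestClosed_of_lattice_stmt L := by
  intro hlat Δ hL lam2 f _ hT k₂ k₃ hp hl
  have h := hlat hL k₂ k₃ hp hl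
  have hc : -1 ≤ Real.cos (2 * Real.pi / L) := Real.neg_one_le_cos _
  have he : 0 ≤ eps1 L := by unfold eps1; linarith [Real.cos_le_one (2 * Real.pi / L)]
  unfold den
  nlinarith [mul_nonneg (by linarith : (0 : ℝ) ≤ 1 + Real.cos (2 * Real.pi / L)) hT]

/-- **`DenMinRest L Δ (2 + cos θ)` from the lattice lemma** (`8 ≤ L`, `Δ ≤ 1`). [folklore] -/
theorem denMinRest_of_lattice (hlat : DenMinRestLattice L) (hL : 8 ≤ L) {Δ : ℝ} (hΔ : Δ ≤ 1) :
    DenMinRest L Δ (2 + Real.cos (2 * Real.pi / L)) := by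
  intro lam2 f hf k₂ k₃ hp hl
  exact denMinRestClosed_of_lattice L hlat Δ hL lam2 f hf (Tplus_nonneg L (by omega) hΔ hf) k₂ k₃ hp hl

end Summit.HubbardSuperconductivity.HubbardSuperconductivity.Theorems.AnisotropyChord.Transfer.Fibre3

end
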